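import Literature.NumberTheory.PAdicHodge.AinfRamifiedKummerIntegral
import Literature.NumberTheory.PAdicHodge.AinfRamifiedQuasiPeriodTwoCocycle
import Literature.NumberTheory.PAdicHodge.AinfRamifiedEtaPeriodHom
import HarnessLib

/-!
# The η-integrating element `b_η ∈ B_dR⁺(F)` of the Kummer cocycle of a RATIONAL point of `Ŵ` over the ramified base `𝒪_D`:
# `(σ − 1) b_η = ∫_{κ_u(σ)} η`, and the integrating PAIR `(b_ω, b_η)`

Topic `Literature/NumberTheory/PAdicHodge`; namespace `Literature.NumberTheory.PAdicHodge.AinfRamTop`. The ramified twin of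
`AinfWeierstrassKummerIntegralEta` (floor 3, η-part, of brick K1 «Kummer classes die in `H¹(F, B_dR⁺ ⊗ V_pW)`» of the hT₂ programme
of crux K★ stmt-BirchSwinnertonDyer-22226, memo `Summits/…/Cruxes/StarredOptimalManinUnitFiveSeven/Lines/kato-lever-hT2-programme.md` §4):
sequel of `AinfRamifiedKummerIntegral` (`z_u = [ũ] − Q ∈ Ŵ(ker θ_𝒪)`, `σ z_u = z_u + [κ_u σ]`, `b_ω = log_W(ι_𝒪 z_u)`), of
`AinfRamifiedEtaPeriod{,Add,Hom}` (`∫_t η = η₀(ι_𝒪[t]) − ι_𝒪(corr t)`, `corr(t ⊕ t') = corr t + corr t' + C([t],[t'])`, equivariance)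
and of `AinfRamifiedQuasiPeriodTwoCocycle` (`C` is a 2-cocycle). With `b_η := η₀(ι_𝒪 z_u) + ι_𝒪 C(Q, z_u) − ι_𝒪(corr u)`:

* §1 `etaKer z = η₀(ι_𝒪 z)` on `Ŵ(ker θ_𝒪)`: `Γ_F`-equivariant, additive up to `ι_𝒪 C(z, z')` (`etaKer_add`);
* §2 `σu = u ⊕ κ_u(σ)` termwise and `corr(σu) = corr u + corr κ_u(σ) + C([ũ], [κ_u σ])` (`etaCorr_galSeq`);
* §3 ★ `gal_bEta_sub_bEta_eq_etaPeriodHomO` — `σ(b_η) − b_η = ∫_{κ_u σ} η = etaPeriodHomO (kummerCocycleO u σ)`, the integrating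
  PAIR `exists_integratingPair_kummerCocycleO`, and `exists_integratingPair_of_coeffDisc` for `𝒪_D`-rational base points.
Definitions `etaKer`, `bEta`; no named fact, no `sorry`, no instance. BSD / K★ are not proved by any of this.

References: [BlochKato1990] Ex. 3.10.1, (3.11.1); [Kato1993LNM1553] Ch. II Lemma 1.4.3; [Colmez1992PeriodesAbeliennes] §2;
[Katz1981CrystallineDieudonne] §5.1; [FontaineAsterisque223III] Exp. II §1.2, §1.5; [SilvermanAEC2009] IV.2.3.
-/

noncomputable section

open Ideal Filter Topology Field WittVector MvPowerSeries ValuativeRel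

namespace Literature.NumberTheory.PAdicHodge

open Literature.NumberTheory.GaloisRepresentations
open Literature.NumberTheory.GaloisRepresentations.IsNonarchimedeanLocalField
open Literature.NumberTheory.GaloisRepresentations.LubinTate
open Literature.NumberTheory.EllipticCurves

namespace AinfRamTop

variable {F : Type} [Field F] [ValuativeRel F] [TopologicalSpace F] [IsNonarchimedeanLocalField F] [CharZero F]
  {p : ℕ} [Fact p.Prime] [Fact (¬ IsUnit (p : integerC F))] [IsAdicComplete (Ideal.span {(p : integerC F)}) (integerC F)]
  {hp : valuation F p < 1} {D : EisensteinRoot F p hp} {hθ : Function.Surjective (fontaineTheta (integerC F) p)}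
  (W : WeierstrassCurve (EisensteinRoot.CoeffDisc D))

/-! ## §1 `η₀` on `Ŵ(ker θ_𝒪)` and its additivity with cocycle -/

/-- **`η₀(ι_𝒪 z) ∈ B_dR⁺(F)`** for `z ∈ Ŵ(𝔫_𝒪)` with `θ_𝒪(z) = 0`: the quasi-period function evaluated `ξ`-adically at `ι_𝒪 z ∈ Fil¹`.
[cite: Colmez1992PeriodesAbeliennes, §2] [cite: Katz1981CrystallineDieudonne, §5.1] -/
def etaKer (z : W.Pt (nilTheta D hθ)) (hz : thetaPt W hθ z = 0) : BdRPlusTop F p :=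
  (evalPt₁ (BdRPlusTop.filOne F p) (etaSeries hθ W) (constantCoeff_etaSeries W) (kerFil W z hz) : BdRPlusTop F p)

/-- `etaKer` respects equality of points (and ignores the proof). [cite: Colmez1992PeriodesAbeliennes, §2] -/
theorem etaKer_congr {z z' : W.Pt (nilTheta D hθ)} (h : z = z') (hz : thetaPt W hθ z = 0) (hz' : thetaPt W hθ z' = 0) :
    etaKer W z hz = etaKer W z' hz' := by subst h; rfl

/-- `etaKer` of Fontaine's element of a torsion SEQUENCE is the main term of its η-period. [cite: Colmez1992PeriodesAbeliennes, §2] -/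
theorem etaKer_divisionLiftPt_of_zero {t : ℕ → (maxNilIdealC F).toIdeal} (ht0 : (t 0 : CBall F) = 0)
    (htp : ∀ n, mulPC W (t (n + 1)) = t n) (h : thetaPt W hθ (divisionLiftPt W hθ t htp) = 0) :
    etaKer W (divisionLiftPt W hθ t htp) h = etaPeriodMain W hθ t ht0 htp := rfl

/-- **`Γ_F`-equivariance: `σ(η₀(ι_𝒪 z)) = η₀(ι_𝒪(σ z))`.** [cite: FontaineAsterisque223III, Exp. II §1.5.4] -/
theorem gal_etaKer (σ : absoluteGaloisGroup F) (z : W.Pt (nilTheta D hθ)) (hz : thetaPt W hθ z = 0) :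
    BdRPlusTop.gal F p σ (etaKer W z hz) = etaKer W (galPtN W hθ σ z) (thetaPt_galPtN_eq_zero W σ hz) := by
  rw [etaKer, etaKer, FieldCoeff.gal_evalPt₁]
  congr 2
  exact Subtype.ext (gal_coe_kerFil W σ z hz)

/-- **The cocycle term comes from `A_inf(𝒪)`**: `C₀(ι_𝒪 z, ι_𝒪 z') = ι_𝒪(C(z, z'))` in `B_dR⁺`, for `z, z' ∈ Ŵ(ker θ_𝒪)`.
[cite: FontaineAsterisque223III, Exp. II §1.5.2] -/
theorem coe_evalPt_cocycle_kerFil (z z' : W.Pt (nilTheta D hθ)) (hz : thetaPt W hθ z = 0) (hz' : thetaPt W hθ z' = 0) :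
    (evalPt (BdRPlusTop.filOne F p) (W.map (EisensteinRoot.CoeffDisc.toFieldCoeff D hθ)).formalQuasiPeriodCocycle
        (W.map (EisensteinRoot.CoeffDisc.toFieldCoeff D hθ)).constantCoeff_formalQuasiPeriodCocycle ![kerFil W z hz, kerFil W z' hz'] :
        BdRPlusTop F p) =
      BdRPlusTop.of F p (AinfRam.toBdR D hθ ((of D).symm (cocycleAt W hθ z.val z'.val))) := by
  have hCint : (MvPowerSeries.map (EisensteinRoot.CoeffDisc.toFieldCoeff D hθ) (cocycle (hθ := hθ) W)).constantCoeff = 0 :=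
    AinfRamXiTop.constantCoeff_map_eq_zero _ (constantCoeff_cocycle W)
  rw [← congrArg Subtype.val (evalPt_congr (BdRPlusTop.filOne F p) (map_cocycle (hθ := hθ) W) hCint
      (W.map (EisensteinRoot.CoeffDisc.toFieldCoeff D hθ)).constantCoeff_formalQuasiPeriodCocycle ![kerFil W z hz, kerFil W z' hz']),
    cocycleAt]
  symm
  exact AinfRamXiTop.toBdR_evalPt_of_symm (cocycle (hθ := hθ) W) (constantCoeff_cocycle W) hCint _
    (fun i => by
      fin_cases i
      · exact mem_span_omega_of_thetaPt_eq_zero W z hz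
      · exact mem_span_omega_of_thetaPt_eq_zero W z' hz')
    _ (fun i => by fin_cases i <;> rfl)

/-- **Additivity with cocycle: `η₀(ι_𝒪(z + z')) = η₀(ι_𝒪 z) + η₀(ι_𝒪 z') + ι_𝒪 C(z, z')`** on `Ŵ(ker θ_𝒪)`.
[cite: Colmez1992PeriodesAbeliennes, §2] [cite: Katz1981CrystallineDieudonne, §5.1] -/
theorem etaKer_add (z z' : W.Pt (nilTheta D hθ)) (hz : thetaPt W hθ z = 0) (hz' : thetaPt W hθ z' = 0)
    (h : thetaPt W hθ (z + z') = 0) :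
    etaKer W (z + z') h =
      etaKer W z hz + etaKer W z' hz' + BdRPlusTop.of F p (AinfRam.toBdR D hθ ((of D).symm (cocycleAt W hθ z.val z'.val))) := by
  set V := W.map (EisensteinRoot.CoeffDisc.toFieldCoeff D hθ) with hV
  set T := kerFil W z hz
  set T' := kerFil W z' hz'
  have hFq : (MvPowerSeries.map (EisensteinRoot.CoeffDisc.toFieldCoeff D hθ) W.formalGroupLaw).constantCoeff = 0 :=
    AinfRamXiTop.constantCoeff_map_eq_zero _ W.constantCoeff_formalGroupLaw
  -- the point `ι_𝒪(z + z')` of `Fil¹` is `F_V(T, T')`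
  have hpt : kerFil W (z + z') h = evalPt (BdRPlusTop.filOne F p) V.formalGroupLaw V.constantCoeff_formalGroupLaw ![T, T'] := by
    apply Subtype.ext
    rw [coe_kerFil_add W z z' hz hz' h]
    exact congrArg Subtype.val (evalPt_congr (BdRPlusTop.filOne F p) (map_formalGroupLaw_fieldCoeff W) hFq
      V.constantCoeff_formalGroupLaw ![T, T'])
  have hη0 : PowerSeries.constantCoeff V.formalQuasiPeriod = 0 := V.constantCoeff_formalQuasiPeriod
  have hC0 : V.formalQuasiPeriodCocycle.constantCoeff = 0 := V.constantCoeff_formalQuasiPeriodCocycle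
  have hsub0 : (V.formalQuasiPeriod.subst V.formalGroupLaw).constantCoeff = 0 :=
    constantCoeff_subst_zero (σ := Unit) (fun _ => V.constantCoeff_formalGroupLaw) hη0
  have hX0 : ∀ i : Fin 2, (V.formalQuasiPeriod.subst (MvPowerSeries.X i : MvPowerSeries (Fin 2) (FieldCoeff hp hθ))).constantCoeff = 0 :=
    fun i => constantCoeff_subst_zero (σ := Unit) (fun _ => MvPowerSeries.constantCoeff_X i) hη0
  have hsum0 : (V.formalQuasiPeriod.subst (MvPowerSeries.X 0 : MvPowerSeries (Fin 2) (FieldCoeff hp hθ)) +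
      V.formalQuasiPeriod.subst (MvPowerSeries.X 1 : MvPowerSeries (Fin 2) (FieldCoeff hp hθ)) + V.formalQuasiPeriodCocycle).constantCoeff
      = 0 := by
    rw [map_add, map_add, hX0 0, hX0 1, hC0, add_zero, add_zero]
  have hcoc : (evalPt (BdRPlusTop.filOne F p) V.formalQuasiPeriodCocycle hC0 ![T, T'] : BdRPlusTop F p) =
      BdRPlusTop.of F p (AinfRam.toBdR D hθ ((of D).symm (cocycleAt W hθ z.val z'.val))) :=
    coe_evalPt_cocycle_kerFil W z z' hz hz'
  rw [etaKer, etaKer, etaKer, hpt]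
  have hl : ∀ (x : (BdRPlusTop.filOne F p).toIdeal),
      (evalPt₁ (BdRPlusTop.filOne F p) (etaSeries hθ W) (constantCoeff_etaSeries W) x : BdRPlusTop F p) =
        evalPt₁ (BdRPlusTop.filOne F p) V.formalQuasiPeriod hη0 x := fun x => rfl
  rw [hl, hl, hl, ← evalPt₁_subst (BdRPlusTop.filOne F p) V.formalGroupLaw V.constantCoeff_formalGroupLaw V.formalQuasiPeriod hη0 hsub0,
    evalPt_congr (BdRPlusTop.filOne F p) (AinfTop.formalQuasiPeriod_subst_formalGroupLaw_eq V) hsub0 hsum0 ![T, T'], coe_evalPt, map_add,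
    map_add, ← coe_evalPt (BdRPlusTop.filOne F p) _ (hX0 0), ← coe_evalPt (BdRPlusTop.filOne F p) _ (hX0 1),
    ← coe_evalPt (BdRPlusTop.filOne F p) _ hC0,
    evalPt₁_subst (BdRPlusTop.filOne F p) (MvPowerSeries.X 0 : MvPowerSeries (Fin 2) (FieldCoeff hp hθ)) (MvPowerSeries.constantCoeff_X 0)
      V.formalQuasiPeriod hη0 (hX0 0),
    evalPt₁_subst (BdRPlusTop.filOne F p) (MvPowerSeries.X 1 : MvPowerSeries (Fin 2) (FieldCoeff hp hθ)) (MvPowerSeries.constantCoeff_X 1)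
      V.formalQuasiPeriod hη0 (hX0 1), evalPt_X, evalPt_X, hcoc]
  rfl

/-! ## §2 `σu = u ⊕ κ_u(σ)` and the correction of the translated sequence -/

section GalSeq

variable (ψ : EisensteinRoot.CoeffDisc D →+* LTCoeff F) {hψ : ∀ c, algebraMap (LTCoeff F) F (ψ c) = EisensteinRoot.CoeffDisc.toF D c}

omit [Fact (¬ IsUnit (p : integerC F))] [IsAdicComplete (Ideal.span {(p : integerC F)}) (integerC F)] in
include hψ in
/-- **`σu = u ⊕ κ_u(σ)` termwise** (`σuₙ = uₙ + (σuₙ − uₙ)` in `Ŵ♭(𝔪_{ℂ_F})`, `⊕` in the `𝒪_D`-currency `addSeq W`).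
[cite: BlochKato1990, Ex. 3.10.1] -/
theorem galSeq_eq_addSeq_kummerSeqO (σ : absoluteGaloisGroup F) (u : ℕ → (maxNilIdealC F).toIdeal) :
    AinfTop.galSeq F σ u = addSeq W u (kummerSeqO W ψ σ u) := by
  funext n
  have h : (σ • (⟨u n⟩ : (W.map ψ).Pt (maxNilIdealC F))) =
      ⟨u n⟩ + ((σ • (⟨u n⟩ : (W.map ψ).Pt (maxNilIdealC F))) - ⟨u n⟩) := (add_sub_cancel _ _).symm
  have h' := congrArg WeierstrassCurve.Pt.val h
  rw [val_add_map_ψ W ψ hψ] at h'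
  exact h'

/-- `ι_𝒪(σ c) = σ(ι_𝒪 c)` for `ι_𝒪 = (A_inf(𝒪) → B_dR⁺)` in the `AinfRamTop` dialect. [cite: FontaineAsterisque223III, Exp. II §1.5] -/
theorem gal_of_toBdR_symm (σ : absoluteGaloisGroup F) (c : AinfRamTop D) :
    BdRPlusTop.gal F p σ (BdRPlusTop.of F p (AinfRam.toBdR D hθ ((of D).symm c))) =
      BdRPlusTop.of F p (AinfRam.toBdR D hθ ((of D).symm (gal D σ c))) := by
  rw [BdRPlusTop.gal_of, AinfRam.galBdRPlus_toBdR]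
  rfl

/-- `C([t], [t'])` along Fontaine's elements of two sequences is the `0`-th term `D₀` of the tree's `cocycleShift`.
[cite: Katz1981CrystallineDieudonne, §5.1] -/
theorem cocycleShift_zero_eq {t t' : ℕ → (maxNilIdealC F).toIdeal} (htp : ∀ n, mulPC W (t (n + 1)) = t n)
    (htp' : ∀ n, mulPC W (t' (n + 1)) = t' n) :
    cocycleShift W hθ t t' htp htp' 0 = cocycleAt W hθ (divisionLiftPt W hθ t htp).val (divisionLiftPt W hθ t' htp').val := rfl

/-- Congruence for `etaCorr` in the sequence. [cite: Colmez1992PeriodesAbeliennes, §2] -/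
theorem etaCorr_congr_seq {t t' : ℕ → (maxNilIdealC F).toIdeal} (h : t = t') (htp : ∀ n, mulPC W (t (n + 1)) = t n)
    (htp' : ∀ n, mulPC W (t' (n + 1)) = t' n) : etaCorr W hθ t htp = etaCorr W hθ t' htp' := by subst h; rfl

include hψ in
/-- **The correction of the translated sequence: `corr(σu) = corr u + corr κ_u(σ) + C([ũ], [κ_u σ])`** (`σu = u ⊕ κ_u σ` and the
`ht0`-free additivity `etaCorr_addSeq`). [cite: Colmez1992PeriodesAbeliennes, §2] [cite: BlochKato1990, Ex. 3.10.1] -/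
theorem etaCorr_galSeq (σ : absoluteGaloisGroup F) {u : ℕ → (maxNilIdealC F).toIdeal} (hup : ∀ n, mulPC W (u (n + 1)) = u n) :
    etaCorr W hθ (AinfTop.galSeq F σ u) (mulPC_galSeq W hθ σ hup) =
      etaCorr W hθ u hup + etaCorr W hθ (kummerSeqO W ψ σ u) (mulPC_kummerSeqO W ψ (hψ := hψ) σ hup) +
        cocycleAt W hθ (divisionLiftPt W hθ u hup).val
          (divisionLiftPt W hθ (kummerSeqO W ψ σ u) (mulPC_kummerSeqO W ψ (hψ := hψ) σ hup)).val := by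
  have h := etaCorr_addSeq W (hθ := hθ) hup (mulPC_kummerSeqO W ψ (hψ := hψ) σ hup)
  rw [etaCorr_congr_seq W (galSeq_eq_addSeq_kummerSeqO W ψ (hψ := hψ) σ u) (mulPC_galSeq W hθ σ hup)
      (mulPC_addSeq W hup (mulPC_kummerSeqO W ψ (hψ := hψ) σ hup)),
    ← cocycleShift_zero_eq W hup (mulPC_kummerSeqO W ψ (hψ := hψ) σ hup)]
  linear_combination h

end GalSeq

/-! ## §3 The η-integrating element and the integrating pair -/

section Kummer

variable (ψ : EisensteinRoot.CoeffDisc D →+* LTCoeff F) {hψ : ∀ c, algebraMap (LTCoeff F) F (ψ c) = EisensteinRoot.CoeffDisc.toF D c}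
  {u : ℕ → (maxNilIdealC F).toIdeal} (hup : ∀ n, mulPC W (u (n + 1)) = u n) {Q : W.Pt (nilTheta D hθ)}

/-- **The η-integrating element `b_η := η₀(ι_𝒪 z_u) + ι_𝒪 C(Q, z_u) − ι_𝒪(corr u) ∈ B_dR⁺(F)`** of the Kummer cocycle of the
division sequence `u` relative to the fixed lift `Q` of its base point. [cite: BlochKato1990, Ex. 3.10.1] [cite: Colmez1992PeriodesAbeliennes, §2] -/
def bEta (hup : ∀ n, mulPC W (u (n + 1)) = u n) (hQ : thetaPt W hθ Q = ⟨u 0⟩) : BdRPlusTop F p :=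
  etaKer W (kummerIntegralPt W hup Q) (thetaPt_kummerIntegralPt W hup hQ) +
      BdRPlusTop.of F p (AinfRam.toBdR D hθ ((of D).symm (cocycleAt W hθ Q.val (kummerIntegralPt W hup Q).val))) -
    BdRPlusTop.of F p (AinfRam.toBdR D hθ ((of D).symm (etaCorr W hθ u hup)))

/-- `Q + z_u = [ũ]` in `Ŵ(𝔫_𝒪)`. [cite: FontaineAsterisque223III, Exp. II §1.2.2] -/
theorem add_kummerIntegralPt (Q : W.Pt (nilTheta D hθ)) : Q + kummerIntegralPt W hup Q = divisionLiftPt W hθ u hup := by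
  rw [kummerIntegralPt_def, add_sub_cancel]

/-- **THE COBOUNDARY IDENTITY `σ(b_η) − b_η = ∫_{κ_u(σ)} η`** (sequence form). [cite: BlochKato1990, Ex. 3.10.1]
[cite: Kato1993LNM1553, Ch. II Lemma 1.4.3] [cite: Colmez1992PeriodesAbeliennes, §2] -/
theorem gal_bEta_sub_bEta (hQ : thetaPt W hθ Q = ⟨u 0⟩) (hQσ : ∀ σ : absoluteGaloisGroup F, galPtN W hθ σ Q = Q)
    (σ : absoluteGaloisGroup F) :
    BdRPlusTop.gal F p σ (bEta W hup hQ) - bEta W hup hQ =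
      etaPeriod W hθ (kummerSeqO W ψ σ u) (coe_kummerSeqO_zero W ψ σ (galCBall_base_eq_of_fixedLift W hQ hQσ σ))
        (mulPC_kummerSeqO W ψ (hψ := hψ) σ hup) := by
  -- names: `z = z_u`, `k = [κ_u σ]`
  have hz : thetaPt W hθ (kummerIntegralPt W hup Q) = 0 := thetaPt_kummerIntegralPt W hup hQ
  have hk : thetaPt W hθ (divisionLiftPt W hθ (kummerSeqO W ψ σ u) (mulPC_kummerSeqO W ψ (hψ := hψ) σ hup)) = 0 :=
    thetaPt_divisionLiftPt_kummerSeqO W ψ (hψ := hψ) hup hQ hQσ σ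
  have hσz := galPtN_kummerIntegralPt W ψ (hψ := hψ) hup hQσ σ
  -- (1) the main term
  have E1 : BdRPlusTop.gal F p σ (etaKer W (kummerIntegralPt W hup Q) hz) =
      etaKer W (kummerIntegralPt W hup Q) hz +
        etaKer W (divisionLiftPt W hθ (kummerSeqO W ψ σ u) (mulPC_kummerSeqO W ψ (hψ := hψ) σ hup)) hk +
        BdRPlusTop.of F p (AinfRam.toBdR D hθ ((of D).symm (cocycleAt W hθ (kummerIntegralPt W hup Q).val
          (divisionLiftPt W hθ (kummerSeqO W ψ σ u) (mulPC_kummerSeqO W ψ (hψ := hψ) σ hup)).val))) := by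
    rw [gal_etaKer, etaKer_congr W hσz _ (thetaPt_add_eq_zero W hz hk), etaKer_add W _ _ hz hk]
  -- (2) the constant's cocycle term
  have E2 : BdRPlusTop.gal F p σ (BdRPlusTop.of F p (AinfRam.toBdR D hθ ((of D).symm (cocycleAt W hθ Q.val (kummerIntegralPt W hup Q).val)))) =
      BdRPlusTop.of F p (AinfRam.toBdR D hθ ((of D).symm (cocycleAt W hθ Q.val
        (kummerIntegralPt W hup Q + divisionLiftPt W hθ (kummerSeqO W ψ σ u) (mulPC_kummerSeqO W ψ (hψ := hψ) σ hup)).val))) := by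
    rw [gal_of_toBdR_symm, gal_cocycleAt]
    have hQ' : (⟨gal D σ (Q.val : AinfRamTop D), gal_mem_nilTheta σ Q.val.2⟩ : (nilTheta D hθ).toIdeal) = Q.val :=
      congrArg WeierstrassCurve.Pt.val (hQσ σ)
    have hz' : (⟨gal D σ ((kummerIntegralPt W hup Q).val : AinfRamTop D), gal_mem_nilTheta σ (kummerIntegralPt W hup Q).val.2⟩ :
        (nilTheta D hθ).toIdeal) =
        (kummerIntegralPt W hup Q + divisionLiftPt W hθ (kummerSeqO W ψ σ u) (mulPC_kummerSeqO W ψ (hψ := hψ) σ hup)).val :=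
      congrArg WeierstrassCurve.Pt.val hσz
    rw [hQ', hz']
  -- (3) the correction
  have E3 : BdRPlusTop.gal F p σ (BdRPlusTop.of F p (AinfRam.toBdR D hθ ((of D).symm (etaCorr W hθ u hup)))) =
      BdRPlusTop.of F p (AinfRam.toBdR D hθ ((of D).symm (etaCorr W hθ u hup +
        etaCorr W hθ (kummerSeqO W ψ σ u) (mulPC_kummerSeqO W ψ (hψ := hψ) σ hup) +
        cocycleAt W hθ (divisionLiftPt W hθ u hup).val
          (divisionLiftPt W hθ (kummerSeqO W ψ σ u) (mulPC_kummerSeqO W ψ (hψ := hψ) σ hup)).val))) := by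
    rw [gal_of_toBdR_symm, gal_etaCorr W σ hup, etaCorr_galSeq W ψ (hψ := hψ) σ hup]
  -- (4) the 2-cocycle identity with `Q ⊕ z_u = [ũ]`
  have h2c := cocycleAt_two_cocycle W (hθ := hθ) Q.val (kummerIntegralPt W hup Q).val
    (divisionLiftPt W hθ (kummerSeqO W ψ σ u) (mulPC_kummerSeqO W ψ (hψ := hψ) σ hup)).val
  rw [← val_add_N, ← val_add_N, add_kummerIntegralPt W hup Q] at h2c
  have hj := congrArg (fun c : AinfRamTop D => BdRPlusTop.of F p (AinfRam.toBdR D hθ ((of D).symm c))) h2c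
  simp only [map_add] at hj
  rw [bEta, map_sub, map_add, E1, E2, E3, etaPeriod, ← etaKer_divisionLiftPt_of_zero W _ _ hk]
  simp only [map_add]
  linear_combination -hj

/-- **THE COBOUNDARY IDENTITY, Tate-module form: `σ(b_η) − b_η = etaPeriodHomO (kummerCocycleO u σ)`.**
[cite: BlochKato1990, Ex. 3.10.1] [cite: Kato1993LNM1553, Ch. II Lemma 1.4.3] -/
theorem gal_bEta_sub_bEta_eq_etaPeriodHomO (hQ : thetaPt W hθ Q = ⟨u 0⟩)
    (hQσ : ∀ σ : absoluteGaloisGroup F, galPtN W hθ σ Q = Q) (σ : absoluteGaloisGroup F) :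
    BdRPlusTop.gal F p σ (bEta W hup hQ) - bEta W hup hQ =
      etaPeriodHomO W ψ hθ hψ (kummerCocycleO W ψ hψ u hup (galCBall_base_eq_of_fixedLift W hQ hQσ) σ) := by
  rw [gal_bEta_sub_bEta W ψ (hψ := hψ) hup hQ hQσ σ, etaPeriodHomO_apply]
  exact etaPeriod_congr_seq W (seqO_kummerCocycleO W ψ (hψ := hψ) (hup := hup)
    (hu₀ := galCBall_base_eq_of_fixedLift W hQ hQσ) σ).symm _ _ _ _

/-- **Brick K1 over the ramified base, floor 3: the INTEGRATING PAIR of the Kummer cocycle of a division sequence with a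
`Γ_F`-fixed lift of its base point** — `∃ b_ω ∈ Fil¹, b_η ∈ B_dR⁺(F)` with `(σ−1) b_ω = ∫_{κ_u σ} ω` and `(σ−1) b_η = ∫_{κ_u σ} η` for
all `σ ∈ Γ_F`. [cite: BlochKato1990, Ex. 3.10.1, (3.11.1)] [cite: Kato1993LNM1553, Ch. II Lemma 1.4.3] -/
theorem exists_integratingPair_kummerCocycleO (hQ : thetaPt W hθ Q = ⟨u 0⟩)
    (hQσ : ∀ σ : absoluteGaloisGroup F, galPtN W hθ σ Q = Q) :
    ∃ bω bη : BdRPlusTop F p, bω ∈ (BdRPlusTop.filOne F p).toIdeal ∧ ∀ σ : absoluteGaloisGroup F,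
      BdRPlusTop.gal F p σ bω - bω =
          omegaPeriodHomO W ψ hθ hψ (kummerCocycleO W ψ hψ u hup (galCBall_base_eq_of_fixedLift W hQ hQσ) σ) ∧
        BdRPlusTop.gal F p σ bη - bη =
          etaPeriodHomO W ψ hθ hψ (kummerCocycleO W ψ hψ u hup (galCBall_base_eq_of_fixedLift W hQ hQσ) σ) :=
  ⟨bOmega W hup hQ, bEta W hup hQ, bOmega_mem_filOne W hup hQ, fun σ =>
    ⟨gal_bOmega_sub_bOmega_eq_omegaPeriodHomO W ψ hup hQ hQσ σ, gal_bEta_sub_bEta_eq_etaPeriodHomO W ψ hup hQ hQσ σ⟩⟩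

end Kummer

/-- **Brick K1 over the ramified base, floor 3, for `𝒪_D`-rational base points**: a `[p]_W`-division sequence `u` in `Ŵ(𝔪_{ℂ_F})`
whose base point is the `𝒪_D`-rational point with parameter `c ∈ 𝔪_D` has an integrating pair `(b_ω, b_η)` in `B_dR⁺(F)`,
`b_ω ∈ Fil¹`, for BOTH periods of its Kummer cocycle. [cite: BlochKato1990, Ex. 3.10.1, (3.11.1)] [cite: Kato1993LNM1553, Ch. II Lemma 1.4.3] -/
theorem exists_integratingPair_of_coeffDisc (ψ : EisensteinRoot.CoeffDisc D →+* LTCoeff F)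
    {hψ : ∀ c, algebraMap (LTCoeff F) F (ψ c) = EisensteinRoot.CoeffDisc.toF D c}
    {u : ℕ → (maxNilIdealC F).toIdeal} (hup : ∀ n, mulPC W (u (n + 1)) = u n) (c : EisensteinRoot.CoeffDisc D)
    (hc : ‖algebraMap F (CompletedAlgClosure F) (EisensteinRoot.CoeffDisc.toF D c)‖ < 1)
    (hu0 : (u 0 : CBall F) = algebraMap (EisensteinRoot.CoeffDisc D) (CBall F) c) :
    ∃ hu₀ : ∀ σ : absoluteGaloisGroup F, galCBall σ (u 0 : CBall F) = u 0,
      ∃ bω bη : BdRPlusTop F p, bω ∈ (BdRPlusTop.filOne F p).toIdeal ∧ ∀ σ : absoluteGaloisGroup F,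
        BdRPlusTop.gal F p σ bω - bω = omegaPeriodHomO W ψ hθ hψ (kummerCocycleO W ψ hψ u hup hu₀ σ) ∧
          BdRPlusTop.gal F p σ bη - bη = etaPeriodHomO W ψ hθ hψ (kummerCocycleO W ψ hψ u hup hu₀ σ) := by
  have hQ : thetaPt W hθ (coeffPt W hθ c hc) = ⟨u 0⟩ :=
    WeierstrassCurve.Pt.ext (Subtype.ext (by rw [coe_val_thetaPt_coeffPt, hu0]))
  exact ⟨galCBall_base_eq_of_fixedLift W hQ fun σ => galPtN_coeffPt W σ c hc,
    exists_integratingPair_kummerCocycleO W ψ hup hQ fun σ => galPtN_coeffPt W σ c hc⟩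

end AinfRamTop

end Literature.NumberTheory.PAdicHodge

end
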